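import Summits.QuantumFields.BalabanUV.Beta.GAN24.WSlotSourceZeroModeStep
import Summits.QuantumFields.BalabanUV.Beta.GAN24.T2OfBracketBlockCovariance

/-!
# `BalabanUV.Beta.GAN24.WSlotSourceZeroModeZfree` — binder row G-an2-4 ∕ (CONV-C), W-slot road «W3» (gan24-p1 `SKELETON-W3.md` v1.0.2 §8.3),
# ROW W3-F2a `hZ : ∀ m, Zfree (b m)` IN THE `Zfree` OF RECORD (ref2 r57, journal l.9640: «Zfree X := (X jointly Lc-covariant) ∧
# (∀ κ κ′ κ₁ κ₂, zmode Lc X κ κ′ (inl κ₁) (inl κ₂) = 0)» — the inline text of leaf-12's `TransportIrrelevant.hTirr_three_slot`), Part C of the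
# assembly: THE CONJUNCTION at leaf-04's literal bracket, GIVEN the four (S3c)-channel ff double-leg bond sums

NOT IN PRINT; OUR BOOKKEEPING (G-an2-4 formalisation swarm, leaf prover `b2b-balaban-gan24-formalise-leaf-20`, gen 18; journal INTENT «W3-ZS*» l.9181;
name PROVISIONAL).  HONEST FRAMING (cell contract, verbatim): «discharging `BetaPertH` makes Bałaban's UV stability UNCONDITIONAL — a real
constructive-QFT result; it is NOT the continuum limit and NOT the Clay problem.»  HONEST DEPENDENCY (verbatim): «continuum YM on T⁴ ⇐ BetaPertH ∧
nine spine estimates (0/9 proved); BetaPertH ⇐ (D1) ∧ (D4) ∧ CAP+tail; G-an2-4 gates asym, D1 and NE2/3/4.»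

WHAT ([folklore] bookkeeping BY NAME; generic `d`, `1 ≤ Lc`, every `j`, colour constants symbolic; 0 def, 0 cite, 0 `def … : Prop`, 0 sorry):
* §8 `counitK_shiftK`, `unitM₂_translate` — the K-slot change of units of a mixed table commutes with joint block translations (leaf-19's
  `T2SlotCovariance` pattern for the `unitM₂` slot; from an2's `M2Of_translate`): the covariance binder `hM₂t` of Part B from the END's
  raw binder `hmixt` on `mixFF`.
* §9 **`zfree_bracket_of_channels`** — ROW W3-F2a AT MEMBER `j` IN THE `Zfree` OF RECORD: the literal source
  `b_j = (cE₂·Lc^{2(d+1)}) • mmRead Lc (K3OfK K♮_j Lc S♮_j M♮_j (W2SymOfK K♮_j Lc S♮_j M♮_j 0 M₂♮_j) · · ) + cB • mfNeg (vh₂S · ·)` is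
  (i) JOINTLY `Lc`-COVARIANT — leaf-11's `T2OfBracketBlockCovariance.bracket_translate_block` BY NAME (binders: `1 ≤ Lc`, `hmixt` on `mixFF`,
  `hBt` on the border `vh₂S`), and (ii) has VANISHING ff CELL ZERO MODE `zmode Lc (b_j) κ κ′ (inl κ₁) (inl κ₂) = 0` — Part B's
  `zmode_bracket_eq_zero` at period `Lc`, GIVEN the level-`j` shape data of `S♮_j`∕`M♮_j`∕`M₂♮_j` and the four (S3c)-channel ff double-leg
  bond sums (leaf-06-g9's announced «W3-S3C*» PART 6 (B)(C), journal l.9159∕l.9656) at every first bond.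
HONEST: END-as-function; ROW W3-F2a closes when the four channel bond sums land and are plugged BY NAME; NOT «T2Shape», NOT (hW, hWall), 0∕2 wall
binders; NOT «W-slot closed» (nor under an undischarged pin), NEVER «G-an2-4 closed»; NOT BetaPertH, NOT continuum, NOT Clay.
-/

noncomputable section

open Finset
open scoped BigOperators
open Literature.MathematicalPhysics.QuantumFieldTheory
open Literature.MathematicalPhysics.QuantumFieldTheory.Balaban1983to89
open Literature.MathematicalPhysics.QuantumFieldTheory.Balaban1983to89.Beta
open AffineAveraging (Site)
open ExpKernelCalculus (MKer Decays BiLoc VertexFamily comp shiftK)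
open OneStepResolventKernel (Fib LocStencil)
open OneStepKernelFamily (KInvStep)
open StepJetData (mfNeg)
open SecondOrderResponse (dM K2OfK W2SymOfK LocStencilFM)
open BalabanStepW2 (K3OfK Spure M1 M2Of M2Of_translate)
open BalabanStepJetsSucc (mmRead)
open Summit.QuantumFields.BalabanUV.Beta.HessKerDressedUnits (unitK unitS counitK counitK_apply)
open Summit.QuantumFields.BalabanUV.Beta.SecondOrderUnits (unitM unitM₂)
open Summit.QuantumFields.BalabanUV.Beta.GAN24.CombesThomas (sfStep smStep)
open Summit.QuantumFields.BalabanUV.Beta.GAN24.BiStencilZeroMode (Tab zmode)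
open Summit.QuantumFields.BalabanUV.Beta.GAN24.T2OfBracketBlockCovariance (bracket_translate_block)
open Summit.QuantumFields.BalabanUV.Beta.GAN24.WSlotSourceZeroModeStep (zmode_bracket_eq_zero)

namespace Summit.QuantumFields.BalabanUV.Beta.GAN24.WSlotSourceZeroModeZfree

variable {d : ℕ} {Lc : ℕ} [NeZero Lc]

/-! ## §8 The K-slot change of units of a mixed table commutes with joint block translations -/

/-- [folklore] The contragredient change of units is entrywise, hence commutes with translations of both kernel arguments. -/
theorem counitK_shiftK (sf sm : ℝ) (v : Site (d + 1)) (V : MKer (d + 1) (Fib d)) :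
    counitK sf sm (shiftK v V) = shiftK v (counitK sf sm V) := by
  funext x z a b
  simp only [counitK_apply, shiftK]

omit [NeZero Lc] in
/-- [folklore] **THE NORMALISED MIXED TABLE IS JOINTLY BLOCK COVARIANT** when the raw one is: for `M₂ κ (u + Lc•t) ρ (w + t) = shiftK (−Lc•t) (M₂ κ u ρ w)`
(the shape of an2's `M2Of_translate`), `unitM₂ s_f s_m M₂` has the same covariance. -/
theorem unitM₂_translate (sf sm : ℝ) {M₂ : Fin (d + 1) → Site (d + 1) → Fin (d + 1) → Site (d + 1) → MKer (d + 1) (Fib d)}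
    (hM₂t : ∀ (κ : Fin (d + 1)) (u : Site (d + 1)) (ρ : Fin (d + 1)) (w t : Site (d + 1)),
      M₂ κ (u + (Lc : ℤ) • t) ρ (w + t) = shiftK (-((Lc : ℤ) • t)) (M₂ κ u ρ w))
    (κ : Fin (d + 1)) (u : Site (d + 1)) (ρ : Fin (d + 1)) (w t : Site (d + 1)) :
    unitM₂ sf sm M₂ κ (u + (Lc : ℤ) • t) ρ (w + t) = shiftK (-((Lc : ℤ) • t)) (unitM₂ sf sm M₂ κ u ρ w) := by
  funext x z a b
  simp only [unitM₂, unitM, Pi.smul_apply, smul_eq_mul, counitK_apply, shiftK, hM₂t κ u ρ w t]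

/-! ## §9 ROW W3-F2a at member `j` in the `Zfree` of record: joint `Lc`-covariance ∧ vanishing ff cell zero mode -/

section Literal

variable (hLc : 1 ≤ Lc) (cE cVH cΛ cE₂ cB : ℝ) {mixFF : Tab d}
  (hmixt : ∀ (κ : Fin (d + 1)) (u : Fin (d + 1) → ℤ) (ρ : Fin (d + 1)) (w t : Fin (d + 1) → ℤ),
    mixFF κ (u + (Lc : ℤ) • t) ρ (w + t) = shiftK (-((Lc : ℤ) • t)) (mixFF κ u ρ w))
  {vh₂S : Tab d}
  (hBt : ∀ (κ : Fin (d + 1)) (u : Fin (d + 1) → ℤ) (κ' : Fin (d + 1)) (u' t : Fin (d + 1) → ℤ),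
    vh₂S κ (u + (Lc : ℤ) • t) κ' (u' + (Lc : ℤ) • t) = shiftK (-((Lc : ℤ) • t)) (vh₂S κ u κ' u'))
  (hBff : ∀ κ u κ' u' x z (α β : Fin (d + 1)), vh₂S κ u κ' u' x z (Sum.inl α) (Sum.inl β) = 0)
  (j : ℕ) {Cs δs CM δM C₂ δ₂ : ℝ}

include hLc hmixt hBt hBff in
/-- NOT IN PRINT; OUR BOOKKEEPING.  **ROW W3-F2a AT MEMBER `j`, `Zfree` OF RECORD** (ref2 r57: «(jointly Lc-covariant) ∧ (zmode Lc X … (inl)(inl) = 0)»,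
the inline `Zfree` of leaf-12's `TransportIrrelevant.hTirr_three_slot`), for leaf-04's LITERAL source of `T2RecursionAffine.unitS₂_T2Of_succ_affine`:
(i) joint `Lc`-covariance = leaf-11's `bracket_translate_block` (binders `1 ≤ Lc`, `hmixt`, `hBt`); (ii) the ff cell zero mode at period `Lc`
vanishes = Part B's `zmode_bracket_eq_zero`, GIVEN the level-`j` shape data of `S♮_j`, `M♮_j`, `M₂♮_j` (`LocStencil` ∕ `VertexFamily` ∕
`LocStencilFM` — the covariance of `M₂♮_j` is §8 from `hmixt`), the off-diagonal border `hBff`, and the four (S3c)-channel ff double-leg bond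
sums at EVERY first bond (leaf-06-g9's «W3-S3C*» PART 6 (B)(C)). -/
theorem zfree_bracket_of_channels
    (hS : LocStencil (unitS (sfStep Lc j) (smStep d Lc j) (Spure d Lc cE cVH cΛ j)) Cs δs) (hδs : 0 < δs)
    (hM : VertexFamily (unitM (sfStep Lc j) (smStep d Lc j) (M1 d Lc cΛ j)) Lc CM δM) (hδM : 0 < δM)
    (hM₂ : LocStencilFM Lc (unitM₂ (sfStep Lc j) (smStep d Lc j) (M2Of d Lc mixFF j)) C₂ δ₂) (hδ₂ : 0 < δ₂)
    (hE₁ : ∀ (κ : Fin (d + 1)) (u : Site (d + 1)) (κ' α β : Fin (d + 1)),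
      HasSum (fun u' : Site (d + 1) => ∑' yw : Site (d + 1) × Site (d + 1),
      comp (comp (dM (unitK (sfStep Lc j) (smStep d Lc j) (KInvStep (d := d) Lc j)) Lc
          (unitS (sfStep Lc j) (smStep d Lc j) (Spure d Lc cE cVH cΛ j)) (unitM (sfStep Lc j) (smStep d Lc j) (M1 d Lc cΛ j)) κ u)
        (unitK (sfStep Lc j) (smStep d Lc j) (KInvStep (d := d) Lc j)))
        (dM (unitK (sfStep Lc j) (smStep d Lc j) (KInvStep (d := d) Lc j)) Lc
          (unitS (sfStep Lc j) (smStep d Lc j) (Spure d Lc cE cVH cΛ j)) (unitM (sfStep Lc j) (smStep d Lc j) (M1 d Lc cΛ j)) κ' u')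
        yw.1 yw.2 (Sum.inl α) (Sum.inl β)) 0)
    (hE₂ : ∀ (κ : Fin (d + 1)) (u : Site (d + 1)) (κ' α β : Fin (d + 1)),
      HasSum (fun u' : Site (d + 1) => ∑' yw : Site (d + 1) × Site (d + 1),
      comp (comp (dM (unitK (sfStep Lc j) (smStep d Lc j) (KInvStep (d := d) Lc j)) Lc
          (unitS (sfStep Lc j) (smStep d Lc j) (Spure d Lc cE cVH cΛ j)) (unitM (sfStep Lc j) (smStep d Lc j) (M1 d Lc cΛ j)) κ' u')
        (unitK (sfStep Lc j) (smStep d Lc j) (KInvStep (d := d) Lc j)))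
        (dM (unitK (sfStep Lc j) (smStep d Lc j) (KInvStep (d := d) Lc j)) Lc
          (unitS (sfStep Lc j) (smStep d Lc j) (Spure d Lc cE cVH cΛ j)) (unitM (sfStep Lc j) (smStep d Lc j) (M1 d Lc cΛ j)) κ u)
        yw.1 yw.2 (Sum.inl α) (Sum.inl β)) 0)
    (hR₁ : ∀ (κ : Fin (d + 1)) (u : Site (d + 1)) (κ' α β : Fin (d + 1)),
      HasSum (fun u' : Site (d + 1) => ∑' yw : Site (d + 1) × Site (d + 1),
      dM (K2OfK (unitK (sfStep Lc j) (smStep d Lc j) (KInvStep (d := d) Lc j)) Lc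
          (unitS (sfStep Lc j) (smStep d Lc j) (Spure d Lc cE cVH cΛ j)) (unitM (sfStep Lc j) (smStep d Lc j) (M1 d Lc cΛ j)) κ' u') Lc
        (unitS (sfStep Lc j) (smStep d Lc j) (Spure d Lc cE cVH cΛ j)) (unitM (sfStep Lc j) (smStep d Lc j) (M1 d Lc cΛ j)) κ u
        yw.1 yw.2 (Sum.inl α) (Sum.inl β)) 0)
    (hR₂ : ∀ (κ : Fin (d + 1)) (u : Site (d + 1)) (κ' α β : Fin (d + 1)),
      HasSum (fun u' : Site (d + 1) => ∑' yw : Site (d + 1) × Site (d + 1),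
      dM (K2OfK (unitK (sfStep Lc j) (smStep d Lc j) (KInvStep (d := d) Lc j)) Lc
          (unitS (sfStep Lc j) (smStep d Lc j) (Spure d Lc cE cVH cΛ j)) (unitM (sfStep Lc j) (smStep d Lc j) (M1 d Lc cΛ j)) κ u) Lc
        (unitS (sfStep Lc j) (smStep d Lc j) (Spure d Lc cE cVH cΛ j)) (unitM (sfStep Lc j) (smStep d Lc j) (M1 d Lc cΛ j)) κ' u'
        yw.1 yw.2 (Sum.inl α) (Sum.inl β)) 0) :
    (∀ (κ : Fin (d + 1)) (u : Site (d + 1)) (κ' : Fin (d + 1)) (u' t : Site (d + 1)),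
      (fun κ u κ' u' => (cE₂ * (Lc : ℝ) ^ (2 * (d + 1))) •
          mmRead Lc (K3OfK (unitK (sfStep Lc j) (smStep d Lc j) (KInvStep (d := d) Lc j)) Lc
            (unitS (sfStep Lc j) (smStep d Lc j) (Spure d Lc cE cVH cΛ j)) (unitM (sfStep Lc j) (smStep d Lc j) (M1 d Lc cΛ j))
            (W2SymOfK (unitK (sfStep Lc j) (smStep d Lc j) (KInvStep (d := d) Lc j)) Lc
              (unitS (sfStep Lc j) (smStep d Lc j) (Spure d Lc cE cVH cΛ j)) (unitM (sfStep Lc j) (smStep d Lc j) (M1 d Lc cΛ j)) 0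
              (unitM₂ (sfStep Lc j) (smStep d Lc j) (M2Of d Lc mixFF j))) κ u κ' u')
        + cB • mfNeg (vh₂S κ u κ' u')) κ (u + (Lc : ℤ) • t) κ' (u' + (Lc : ℤ) • t)
      = shiftK (-((Lc : ℤ) • t)) ((fun κ u κ' u' => (cE₂ * (Lc : ℝ) ^ (2 * (d + 1))) •
          mmRead Lc (K3OfK (unitK (sfStep Lc j) (smStep d Lc j) (KInvStep (d := d) Lc j)) Lc
            (unitS (sfStep Lc j) (smStep d Lc j) (Spure d Lc cE cVH cΛ j)) (unitM (sfStep Lc j) (smStep d Lc j) (M1 d Lc cΛ j))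
            (W2SymOfK (unitK (sfStep Lc j) (smStep d Lc j) (KInvStep (d := d) Lc j)) Lc
              (unitS (sfStep Lc j) (smStep d Lc j) (Spure d Lc cE cVH cΛ j)) (unitM (sfStep Lc j) (smStep d Lc j) (M1 d Lc cΛ j)) 0
              (unitM₂ (sfStep Lc j) (smStep d Lc j) (M2Of d Lc mixFF j))) κ u κ' u')
        + cB • mfNeg (vh₂S κ u κ' u')) κ u κ' u')) ∧
    (∀ (κ κ' κ₁ κ₂ : Fin (d + 1)),
      zmode Lc (fun κ u κ' u' => (cE₂ * (Lc : ℝ) ^ (2 * (d + 1))) •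
          mmRead Lc (K3OfK (unitK (sfStep Lc j) (smStep d Lc j) (KInvStep (d := d) Lc j)) Lc
            (unitS (sfStep Lc j) (smStep d Lc j) (Spure d Lc cE cVH cΛ j)) (unitM (sfStep Lc j) (smStep d Lc j) (M1 d Lc cΛ j))
            (W2SymOfK (unitK (sfStep Lc j) (smStep d Lc j) (KInvStep (d := d) Lc j)) Lc
              (unitS (sfStep Lc j) (smStep d Lc j) (Spure d Lc cE cVH cΛ j)) (unitM (sfStep Lc j) (smStep d Lc j) (M1 d Lc cΛ j)) 0
              (unitM₂ (sfStep Lc j) (smStep d Lc j) (M2Of d Lc mixFF j))) κ u κ' u')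
        + cB • mfNeg (vh₂S κ u κ' u')) κ κ' (Sum.inl κ₁) (Sum.inl κ₂) = 0) := by
  refine ⟨fun κ u κ' u' t => bracket_translate_block hLc cE cVH cΛ hmixt hBt cE₂ cB j κ u κ' u' t, fun κ κ' κ₁ κ₂ => ?_⟩
  exact zmode_bracket_eq_zero cE cVH cΛ cE₂ cB mixFF j Lc hBff hS hδs hM hδM hM₂ hδ₂
    (fun κ u ρ w t => unitM₂_translate (sfStep Lc j) (smStep d Lc j) (fun κ u ρ w t => M2Of_translate hmixt j κ u ρ w t) κ u ρ w t)
    κ κ' κ₁ κ₂ (hE₁ κ · κ' κ₁ κ₂) (hE₂ κ · κ' κ₁ κ₂) (hR₁ κ · κ' κ₁ κ₂) (hR₂ κ · κ' κ₁ κ₂)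

end Literal

end Summit.QuantumFields.BalabanUV.Beta.GAN24.WSlotSourceZeroModeZfree

end
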